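import Summits.CriticalPhenomena.Ising3DConformalLimit.Theorems.PerfectScreeningCoulombImpliesNontrivialUpperIsothermOfSusceptibility
import Literature.Probability.LatticeModels.GHSInequality

/-!
# The field form of the residual follows from the isotherm bound (line `SketchPub`, S6 ⟹ S6a)

Crux `CoulombImpliesNontrivial` of route `PerfectScreening` (Ising3DConformalLimit), item
stmt-CriticalPhenomena-13885. The first lead reshaped the residual S6 (`Coulomb ⟹ m(β_c,h) ≤ A h^{1/5}`)
into the field form S6a (`Coulomb ⟹ Σ_{x∈Λ}⟨σ₀;σ_x⟩_{β_c,h}·m(β_c,h)⁴ ≤ C`) plus the integration step S6b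
(S6a ⟹ S6, landed). This file proves the converse bookkeeping, S6 ⟹ S6a, so that the two residual forms are
EQUIVALENT: by GHS, the susceptibility in a field is at most `m(h)/(βh)`.

* `sum_plusTrunc_le_mag_div` — **weak GHS bound on the plus-state susceptibility in a field**: for `β > 0`,
  `h > 0` and every finite `Λ ⊂ ℤ^d`,
  `Σ_{x∈Λ} (⟨σ₀σ_x⟩⁺_{β,h} - m(β,h)²) ≤ m(β,h)/(βh)`.
  Proof: in a plus box `B ⊇ Λ`, `s ↦ ⟨σ₀⟩⁺_{B,s}` is concave on `[0,∞)` with derivative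
  `β Σ_{y∈B}⟨σ₀;σ_y⟩⁺_{B,s}` nonincreasing in `s` (GHS, `antitoneOn_isingTrunc_field`), so
  `βh Σ_{y∈B}⟨σ₀;σ_y⟩⁺_{B,h} ≤ ⟨σ₀⟩⁺_{B,h} - ⟨σ₀⟩⁺_{B,0} ≤ ⟨σ₀⟩⁺_{B,h}`; the truncated terms are `≥ 0`
  (FKG), so the sum may be restricted to `Λ`; then `B ↑ ℤ^d` (plus boxes converge on local observables,
  translation invariance `⟨σ_y⟩⁺ = m`).
* `stub_susceptibilityOfIsotherm` — S6 ⟹ S6a on `ℤ³` at `β_c`: `χ_Λ(h) m⁴ ≤ m⁵/(β_c h) ≤ A⁵/β_c`.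
-/

noncomputable section

namespace Summit.CriticalPhenomena.Ising3DConformalLimit.PerfectScreeningCoulombImpliesNontrivial

open Literature.Probability.LatticeModels Filter Set Finset
open Literature.Barriers.CriticalPhenomena
open scoped Topology BigOperators

/-- **GHS chord bound in a plus box**: for `β ≥ 0`, `h ≥ 0`,
`β h Σ_{y ∈ box L} ⟨σ₀;σ_y⟩⁺_{box L;β,h} ≤ ⟨σ₀⟩⁺_{box L;β,h} - ⟨σ₀⟩⁺_{box L;β,0}` (the derivative
`βΣ_y⟨σ₀;σ_y⟩⁺_{Λ,s}` of the concave `s ↦ ⟨σ₀⟩⁺_{Λ,s}` is smallest at `s = h` on `[0,h]`). -/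
theorem field_mul_sum_boxTrunc_le {d : ℕ} {β : ℝ} (hβ : 0 ≤ β) {h : ℝ} (hh : 0 ≤ h) (L : ℕ) :
    β * (∑ y ∈ box d L,
        (isingExpect (zdGraph d) (box d L) β h .plus (fun σ => spinAt 0 σ * spinAt y σ) -
          isingExpect (zdGraph d) (box d L) β h .plus (spinAt 0) *
            isingExpect (zdGraph d) (box d L) β h .plus (spinAt y))) * h ≤
      isingExpect (zdGraph d) (box d L) β h .plus (spinAt 0) -
        isingExpect (zdGraph d) (box d L) β 0 .plus (spinAt 0) := by
  set f : ℝ → ℝ := fun s => isingExpect (zdGraph d) (box d L) β s .plus (spinAt 0) with hf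
  set D : ℝ := β * ∑ y ∈ box d L,
      (isingExpect (zdGraph d) (box d L) β h .plus (fun σ => spinAt 0 σ * spinAt y σ) -
        isingExpect (zdGraph d) (box d L) β h .plus (spinAt 0) *
          isingExpect (zdGraph d) (box d L) β h .plus (spinAt y)) with hD
  have hderiv : ∀ s, HasDerivAt f (β * ∑ y ∈ box d L,
      (isingExpect (zdGraph d) (box d L) β s .plus (fun σ => spinAt 0 σ * spinAt y σ) -
        isingExpect (zdGraph d) (box d L) β s .plus (spinAt 0) *
          isingExpect (zdGraph d) (box d L) β s .plus (spinAt y))) s :=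
    fun s => hasDerivAt_isingExpect_spinAt_field (zdGraph d) (box d L) β s .plus 0
  have hbound : ∀ s ∈ interior (Icc 0 h), D ≤ deriv f s := by
    intro s hs
    rw [interior_Icc] at hs
    rw [(hderiv s).deriv, hD]
    refine mul_le_mul_of_nonneg_left (Finset.sum_le_sum fun y hy => ?_) hβ
    exact antitoneOn_isingTrunc_field (zdGraph d) hβ (Or.inr rfl) (zero_mem_box d L) hy
      (show s ∈ Set.Ici (0:ℝ) from hs.1.le) (show h ∈ Set.Ici (0:ℝ) from hh) hs.2.le
  have hcont : ContinuousOn f (Icc 0 h) := fun s _ => (hderiv s).continuousAt.continuousWithinAt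
  have hdiff : DifferentiableOn ℝ f (interior (Icc 0 h)) :=
    fun s _ => (hderiv s).differentiableAt.differentiableWithinAt
  have key := (convex_Icc 0 h).mul_sub_le_image_sub_of_le_deriv hcont hdiff hbound 0
    (left_mem_Icc.2 hh) h (right_mem_Icc.2 hh) hh
  simpa [hf] using key

/-- A finite set of sites lies in some box. -/
theorem exists_box_supset_finset {d : ℕ} (S : Finset (Site d)) : ∃ n, S ⊆ box d n := by
  classical
  refine ⟨S.sup fun y => Finset.univ.sup fun i => (y i).natAbs, fun y hy => ?_⟩
  rw [mem_box]
  intro i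
  have h1 : (y i).natAbs ≤ Finset.univ.sup fun i => (y i).natAbs :=
    Finset.le_sup (f := fun i => (y i).natAbs) (Finset.mem_univ i)
  have h2 : (Finset.univ.sup fun i => (y i).natAbs) ≤
      S.sup fun y => Finset.univ.sup fun i => (y i).natAbs :=
    Finset.le_sup (f := fun y : Site d => Finset.univ.sup fun i => (y i).natAbs) hy
  have := h1.trans h2
  omega

/-- **Weak GHS bound on the plus-state susceptibility in a field**: for `β > 0`, `h > 0` and every
finite `Λ ⊂ ℤ^d`, `Σ_{x∈Λ} (⟨σ₀σ_x⟩⁺_{β,h} - m(β,h)²) ≤ m(β,h)/(βh)` (GHS chord bound in plus boxes,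
positivity of the truncated terms (FKG), plus boxes `↑ ℤ^d`, translation invariance `⟨σ_x⟩⁺ = m`). -/
theorem sum_plusTrunc_le_mag_div {d : ℕ} {β : ℝ} (hβ : 0 < β) {h : ℝ} (hh : 0 < h)
    (Λ : Finset (Site d)) :
    ∑ x ∈ Λ, (plusExpect d β h (spinPair 0 x) - magnetizationInField d β h ^ 2) ≤
      magnetizationInField d β h / (β * h) := by
  classical
  -- a box containing `Λ`
  obtain ⟨L₀, hL₀⟩ : ∃ L₀ : ℕ, Λ ⊆ box d L₀ := exists_box_supset_finset Λ
  -- finite-volume bound, for every `L ≥ L₀`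
  have hfin : ∀ L : ℕ, L₀ ≤ L →
      ∑ x ∈ Λ, (isingExpect (zdGraph d) (box d L) β h .plus (fun σ => spinAt 0 σ * spinAt x σ) -
          isingExpect (zdGraph d) (box d L) β h .plus (spinAt 0) *
            isingExpect (zdGraph d) (box d L) β h .plus (spinAt x)) ≤
        isingExpect (zdGraph d) (box d L) β h .plus (spinAt 0) / (β * h) := by
    intro L hL
    have hΛ : Λ ⊆ box d L := hL₀.trans (box_mono d hL)
    have hT0 : ∀ y ∈ box d L, 0 ≤
        isingExpect (zdGraph d) (box d L) β h .plus (fun σ => spinAt 0 σ * spinAt y σ) -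
          isingExpect (zdGraph d) (box d L) β h .plus (spinAt 0) *
            isingExpect (zdGraph d) (box d L) β h .plus (spinAt y) := fun y _ =>
      sub_nonneg.2 (ising_fkg_holds (zdGraph d) hβ.le (box d L) h .plus _ _ (spinAt_mono 0) (spinAt_mono y)
        (measurable_spinAt 0) (measurable_spinAt y))
    have hsub := Finset.sum_le_sum_of_subset_of_nonneg hΛ (fun y hy _ => hT0 y hy)
    have hkey := field_mul_sum_boxTrunc_le (d := d) hβ.le hh.le L
    have hf0 : 0 ≤ isingExpect (zdGraph d) (box d L) β 0 .plus (spinAt 0) := by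
      have hs : spinProduct ({0} : Finset (Site d)) = spinAt 0 := by funext s; simp [spinProduct]
      have h1 := GKSInequalities.gks_one_holds (zdGraph d) (Λ := box d L) (A := {0}) (β := β) (h := 0)
        (bc := .plus) hβ.le le_rfl (Or.inr rfl) (Finset.singleton_subset_iff.2 (zero_mem_box d L))
      rwa [isingCorr, hs] at h1
    rw [le_div_iff₀ (mul_pos hβ hh)]
    calc (∑ x ∈ Λ, (isingExpect (zdGraph d) (box d L) β h .plus (fun σ => spinAt 0 σ * spinAt x σ) -
          isingExpect (zdGraph d) (box d L) β h .plus (spinAt 0) *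
            isingExpect (zdGraph d) (box d L) β h .plus (spinAt x))) * (β * h)
        ≤ (∑ y ∈ box d L, (isingExpect (zdGraph d) (box d L) β h .plus (fun σ => spinAt 0 σ * spinAt y σ) -
          isingExpect (zdGraph d) (box d L) β h .plus (spinAt 0) *
            isingExpect (zdGraph d) (box d L) β h .plus (spinAt y))) * (β * h) :=
          mul_le_mul_of_nonneg_right hsub (mul_pos hβ hh).le
      _ = β * (∑ y ∈ box d L, (isingExpect (zdGraph d) (box d L) β h .plus (fun σ => spinAt 0 σ * spinAt y σ) -
          isingExpect (zdGraph d) (box d L) β h .plus (spinAt 0) *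
            isingExpect (zdGraph d) (box d L) β h .plus (spinAt y))) * h := by ring
      _ ≤ isingExpect (zdGraph d) (box d L) β h .plus (spinAt 0) -
          isingExpect (zdGraph d) (box d L) β 0 .plus (spinAt 0) := hkey
      _ ≤ isingExpect (zdGraph d) (box d L) β h .plus (spinAt 0) := by linarith
  -- pass to the limit `L → ∞`
  have h1 : ∀ w : Site d, Tendsto (fun L : ℕ => isingExpect (zdGraph d) (box d L) β h .plus (spinAt w))
      atTop (𝓝 (plusExpect d β h (spinAt w))) := fun w =>
    tendsto_isingExpect_plus_spinFun (d := d) hβ.le hh.le {w} (fun s => s w) (fun s t hst => hst w (by simp))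
  have h2 : ∀ x : Site d, Tendsto (fun L : ℕ => isingExpect (zdGraph d) (box d L) β h .plus
      (fun σ => spinAt 0 σ * spinAt x σ)) atTop (𝓝 (plusExpect d β h (fun σ => spinAt 0 σ * spinAt x σ))) :=
    fun x => tendsto_isingExpect_plus_spinFun (d := d) hβ.le hh.le {0, x} (fun s => s 0 * s x)
      (fun s t hst => by rw [hst 0 (by simp), hst x (by simp)])
  have hm : ∀ w : Site d, plusExpect d β h (spinAt w) = magnetizationInField d β h := fun w => by
    rw [plusExpect_spinAt_eq_plusExpect_spinAt_zero (fun _ => ising_fkg_holds _) hβ.le h w]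
    rfl
  have hlimL : Tendsto (fun L : ℕ => ∑ x ∈ Λ,
      (isingExpect (zdGraph d) (box d L) β h .plus (fun σ => spinAt 0 σ * spinAt x σ) -
        isingExpect (zdGraph d) (box d L) β h .plus (spinAt 0) *
          isingExpect (zdGraph d) (box d L) β h .plus (spinAt x))) atTop
      (𝓝 (∑ x ∈ Λ, (plusExpect d β h (spinPair 0 x) - magnetizationInField d β h ^ 2))) := by
    refine tendsto_finsetSum _ fun x _ => ?_
    have := (h2 x).sub ((h1 0).mul (h1 x))
    rw [hm 0, hm x, ← sq] at this
    exact this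
  have hlimR : Tendsto (fun L : ℕ => isingExpect (zdGraph d) (box d L) β h .plus (spinAt 0) / (β * h)) atTop
      (𝓝 (magnetizationInField d β h / (β * h))) := by
    have := (h1 0).div_const (β * h)
    rw [hm 0] at this
    exact this
  exact le_of_tendsto_of_tendsto hlimL hlimR (Filter.eventually_atTop.2 ⟨L₀, hfin⟩)

/-- **S6 ⟹ S6a (the field form of the residual follows from the isotherm bound)**: if
`m(β_c,h) ≤ A h^{1/5}` on `(0, h₀]`, then `Σ_{x∈Λ}(⟨σ₀σ_x⟩⁺_{β_c,h} - m²)·m⁴ ≤ (max A 0)⁵/β_c` for all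
finite `Λ ⊂ ℤ³` and `0 < h ≤ h₀` (weak GHS `χ_Λ ≤ m/(β_c h)`, so `χ_Λ m⁴ ≤ m⁵/(β_c h)`). Together with
S6b (`stub_upperIsothermOfSusceptibility`) the two residual forms S6, S6a of line `SketchPub` are equivalent. -/
theorem stub_susceptibilityOfIsotherm :
    (∃ A h₀ : ℝ, 0 < h₀ ∧ ∀ h : ℝ, 0 < h → h ≤ h₀ →
        magnetizationInField 3 (criticalBeta 3) h ≤ A * h ^ ((1:ℝ) / 5)) →
      ∃ C h₀ : ℝ, 0 < h₀ ∧ ∀ h : ℝ, 0 < h → h ≤ h₀ → ∀ Λ : Finset (Site 3),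
        (∑ x ∈ Λ, (plusExpect 3 (criticalBeta 3) h (spinPair 0 x) -
            magnetizationInField 3 (criticalBeta 3) h ^ 2)) *
          magnetizationInField 3 (criticalBeta 3) h ^ 4 ≤ C := by
  rintro ⟨A, h₀, hh₀, hA⟩
  have hβ : 0 < criticalBeta 3 := criticalBeta_pos_holds (d := 3) (by norm_num)
  set A' : ℝ := max A 0 with hA'
  have hA'0 : 0 ≤ A' := le_max_right _ _
  refine ⟨A' ^ 5 / criticalBeta 3, h₀, hh₀, fun h hh hhh₀ Λ => ?_⟩
  set m : ℝ := magnetizationInField 3 (criticalBeta 3) h with hmdef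
  have hm0 : 0 ≤ m := by
    rw [hmdef, magnetizationInField_eq_plusCorr]; exact plusCorr_nonneg hβ.le hh.le {0}
  have hmA : m ≤ A' * h ^ ((1:ℝ) / 5) :=
    (hA h hh hhh₀).trans (mul_le_mul_of_nonneg_right (le_max_left _ _) (by positivity))
  have hχ := sum_plusTrunc_le_mag_div (d := 3) hβ hh Λ
  have hm5 : m ^ 5 ≤ A' ^ 5 * h := by
    calc m ^ 5 ≤ (A' * h ^ ((1:ℝ) / 5)) ^ 5 := by gcongr
      _ = A' ^ 5 * (h ^ ((1:ℝ) / 5)) ^ 5 := mul_pow _ _ 5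
      _ = A' ^ 5 * h := by
          congr 1
          rw [← Real.rpow_natCast, ← Real.rpow_mul hh.le]
          norm_num
  calc (∑ x ∈ Λ, (plusExpect 3 (criticalBeta 3) h (spinPair 0 x) - m ^ 2)) * m ^ 4
      ≤ (m / (criticalBeta 3 * h)) * m ^ 4 := mul_le_mul_of_nonneg_right hχ (by positivity)
    _ = m ^ 5 / (criticalBeta 3 * h) := by ring
    _ ≤ (A' ^ 5 * h) / (criticalBeta 3 * h) := by gcongr
    _ = A' ^ 5 / criticalBeta 3 := by field_simp

end Summit.CriticalPhenomena.Ising3DConformalLimit.PerfectScreeningCoulombImpliesNontrivial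

end
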